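import Summits.QuantumFields.YangMills.Theorems.BalabanUVNodesN15KingModelEuclideanDecay
import Summits.QuantumFields.YangMills.Theorems.BalabanUVNodesN15KingModelSchwingerFunctionsPositivity
import Summits.QuantumFields.YangMills.Theorems.BalabanUVNodesN15KingModelBlockAveragedFreePropagator
import Summits.QuantumFields.YangMills.Theorems.BalabanUVNodesN15KingModelTwoPointMonotonicity
import Summits.QuantumFields.YangMills.Theorems.BalabanUVNodesN15KingModelTwoPointExponentialMoments

/-!
# BalabanUVNodes ∕ N15 — THE KING-MODEL RUNG: PART Ϻ (san) BY NAME — the proper-time ∕ position-space package of King's continuum block two-point function `S₂^{ℝ}`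
# in one theorem (Track A, DAG node N15 = NE2; FAN-OUT v1.1 §N15 s3 «KING-MODEL RUNG»; an index theorem like parts Ϝ∕Ϸ's packages; count-neutral)

HONEST FRAMING.  Count-neutral (cell `pub-ymgap`, seat `pub-ymgap-dag-n15-e` g35; `--supports stmt-QuantumFields-27366 --as helper` = K3⁸).  King's `A = 0`, `g = 0` model
([King1986] C. King, Commun. Math. Phys. **102** (1986) 649–677): `S₂^{ℝ}(z)`, `z ∈ ℤ^{d+1}`, the infinite-volume two-point function of the unit-block averages of the
continuum free field of mass `m = √m²` (the `K → ∞`, `|Ω| → ∞` limit of King's block-spin covariances, parts Ϝ-d∕Ϝ-j; (4.5) p.670, (2.22) p.654).  This file only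
CONJOINS, by name, what parts Ϻ-a … Ϻ-i proved about it: (1) the Schwinger PROPER-TIME representation (Ϻ-b); (2) `S₂^{ℝ} > 0` EVERYWHERE (Ϻ-b); (3) the two-sided
comparison with the continuum free propagator at the extreme block distances (Ϻ-c); (4) Euclidean clustering at every rate `(1−ε)m` with an explicit constant (Ϻ-d);
(5) the ISOTROPIC exact correlation length `log S₂^{ℝ}(z)∕‖z‖₂ → −m` (Ϻ-d); (6) strict positivity of every EVEN thermodynamic-limit Schwinger function (Ϻ-e);
(7) the POSITION-SPACE identification `S₂^{ℝ}(z) = ∫_{B}∫_{B} C_m(‖z+a−b‖₂)` (Ϻ-i); (8) COORDINATEWISE MONOTONICITY (Ϻ-g); (9) EXPONENTIAL MOMENTS up to the mass (Ϻ-h).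
NOT a node discharge (N15 is booked through n15-a's knit, untouched here); nothing Bałaban ∕ continuum-Yang–Mills ∕ `ℝ⁴` ∕ OS reconstruction ∕ Clay; every item is about the
FREE block field and its mass `m`.  0 `sorry`, 0 def; standard axioms.

WHAT THIS FILE PROVES (kernel).  ★★★ **`king_partSan_package`** (the nine-part conjunction, each conjunct a named theorem of parts Ϻ-b…i).

HONEST SCOPE.  Index theorem; no new mathematics beyond its conjuncts.  N15 untouched; counts unmoved.  Locators (use): [King1986] Thm 2.1 (2.22)–(2.23) p.654, (2.3) p.651,
(4.5) p.670, (4.36) p.674, Thm 3.3 (3.6) p.655.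
-/

noncomputable section

open scoped BigOperators Topology
open Filter MeasureTheory Set

namespace Summit.QuantumFields.YangMills.BalabanUVNodes.N15KingModelRung.ProperTime

open Literature.Combinatorics.Enumerative (hafnian)
open Literature.Combinatorics.Enumerative.HafnianGeneratingFunction (subMat)

variable {d : ℕ}

/-- ★★★ **PART Ϻ BY NAME — THE PROPER-TIME ∕ POSITION-SPACE PACKAGE OF `S₂^{ℝ}`** (`m² > 0`, dimension `d+1`):
(1) `S₂^{ℝ}(z) = (2π)^{−(d+1)}∫₀^∞e^{−tm²}Π_μ I_t(z_μ)dt`, `I_t(x) = ∫sinc²(q∕2)e^{−tq²}cos(qx)dq` (part Ϻ-b);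
(2) `S₂^{ℝ}(z) > 0` for every `z` (Ϻ-b);
(3) `C_m(R₊(z)) ≤ S₂^{ℝ}(z)` for every `z`, and `S₂^{ℝ}(z) ≤ C_m(R₋(z))` whenever `R₋(z) > 0` (Ϻ-c);
(4) `S₂^{ℝ}(z) ≤ e^{(1−ε)m(1+√(d+1))}(C_{√εm}(√ε) + m⁻²)·e^{−(1−ε)m‖z‖₂}` for every `0 < ε ≤ 1` and every `z` (Ϻ-d);
(5) `log S₂^{ℝ}(z)∕‖z‖₂ → −√m²` along the cofinite filter of `ℤ^{d+1}` (Ϻ-d);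
(6) `Haf((S₂^{ℝ}(z_v−z_u))_{u,v∈S}) > 0` for every finite `S` of even size (Ϻ-e);
(7) `S₂^{ℝ}(z) = ∫_{a∈(0,1]^{d+1}}∫_{b∈(0,1]^{d+1}} C_m(‖z+a−b‖₂)db da` (Ϻ-i);
(8) `(∀μ, |z_μ| ≤ |z′_μ|) ⇒ S₂^{ℝ}(z′) ≤ S₂^{ℝ}(z)` (Ϻ-g);
(9) `Σ_z S₂^{ℝ}(z)e^{b‖z‖₂} < ∞` for every `b < √m²` (Ϻ-h).
[cite: King1986, Thm 2.1 (2.22)–(2.23) p.654, (4.5) p.670, Thm 3.3 (3.6) p.655] -/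
theorem king_partSan_package {m2 : ℝ} (hm : 0 < m2) :
    (∀ z : Fin (d + 1) → ℤ, kingS2Inf m2 z = ((2 * Real.pi) ^ (d + 1))⁻¹ * ∫ t in Ioi (0 : ℝ), Real.exp (-(t * m2)) * ∏ μ, lineHeat t (z μ))
    ∧ (∀ z : Fin (d + 1) → ℤ, 0 < kingS2Inf m2 z)
    ∧ (∀ z : Fin (d + 1) → ℤ, freePropRadial d m2 (blockSpan z) ≤ kingS2Inf m2 z ∧ (0 < blockGap z → kingS2Inf m2 z ≤ freePropRadial d m2 (blockGap z)))
    ∧ (∀ ε : ℝ, 0 < ε → ε ≤ 1 → ∀ z : Fin (d + 1) → ℤ,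
        kingS2Inf m2 z ≤ Real.exp ((1 - ε) * Real.sqrt m2 * (1 + Real.sqrt (d + 1))) * (freePropRadial d (ε * m2) (Real.sqrt ε) + m2⁻¹)
          * Real.exp (-((1 - ε) * Real.sqrt m2 * ‖WithLp.toLp 2 (fun μ => (z μ : ℝ))‖)))
    ∧ Tendsto (fun z : Fin (d + 1) → ℤ => Real.log (kingS2Inf m2 z) / ‖WithLp.toLp 2 (fun μ => (z μ : ℝ))‖) cofinite (𝓝 (-Real.sqrt m2))
    ∧ (∀ (W : Type) [DecidableEq W] [LinearOrder W] (z : W → Fin (d + 1) → ℤ) (S : Finset W), Even S.card →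
        0 < hafnian (subMat (Matrix.of fun u v : W => kingS2Inf m2 (z v - z u)) S))
    ∧ (∀ z : Fin (d + 1) → ℤ, kingS2Inf m2 z = ∫ a in Set.pi univ (fun _ : Fin (d + 1) => Ioc (0 : ℝ) 1), ∫ b in Set.pi univ (fun _ : Fin (d + 1) => Ioc (0 : ℝ) 1),
        freePropRadial d m2 (Real.sqrt (∑ μ, ((z μ : ℝ) + a μ - b μ) ^ 2)))
    ∧ (∀ z z' : Fin (d + 1) → ℤ, (∀ μ, |z μ| ≤ |z' μ|) → kingS2Inf m2 z' ≤ kingS2Inf m2 z)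
    ∧ (∀ b : ℝ, b < Real.sqrt m2 → Summable fun z : Fin (d + 1) → ℤ => kingS2Inf m2 z * Real.exp (b * ‖WithLp.toLp 2 (fun μ => (z μ : ℝ))‖)) :=
  ⟨fun z => kingS2Inf_eq_integral_properTime hm z,
    fun z => kingS2Inf_pos hm z,
    fun z => ⟨freePropRadial_le_kingS2Inf hm z, fun hgap => kingS2Inf_le_freePropRadial hm hgap⟩,
    fun _ hε0 hε1 z => kingS2Inf_le_const_mul_exp_neg_norm hm hε0 hε1 z,
    tendsto_log_kingS2Inf_div_norm hm,
    fun _ _ _ z _ hS => hafnian_kingS2Inf_pos hm z hS,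
    fun z => kingS2Inf_eq_blockAverage_freePropRadial hm z,
    fun _ _ h => kingS2Inf_anti_abs hm h,
    fun _ hb => summable_kingS2Inf_mul_exp_norm hm hb⟩

end Summit.QuantumFields.YangMills.BalabanUVNodes.N15KingModelRung.ProperTime
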